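import Summits.Ventures.PercRepro.C041TriangleSeedRegion

/-!
# THE CERTIFICATE `L_crown` FOR `θ_△(v 1, w)` — two data atoms, one of them unprefactored (mine-3, gen 65; C-041.md §21 (az))

`L₁` (C041TriangleSeedRegion) writes `θ_△(v 1, w) = M₀(θ)·𝟙 + 2(T₂ + I₂)·v 0 + v 1·(λ′·𝟙 + c₁·v 1 + c_t·v t)` and needs the
Hankel room `m₂ Δ₂ ≥ (Δ₁ − Δ₂)²`, i.e. `P₂ − 1 ≳ 3(1 − A)²/P₁` — too much for the stars near the all-ones star (three leaves
near `1` have `P₂ − 1 ≈ (1 − A)²/3` at `P₁ ≈ 8`).  `L_crown` moves part of the coordinate-4 deficit `Δ₁` to an UNPREFACTORED data atom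
`v s` (which costs coordinate 1 like `v 1`, not like `v 1²`): with `D := θ₅ − θ₃ = 2(T₂ + I₂)`, a split `y = ρ Δ₁` and
`s = y/(y + D)`, `c' = (y + D)²/D`, `t = 1 − Δ₂/((1 − ρ)Δ₁)`, `c = ((1 − ρ)Δ₁)²/Δ₂`,
  `θ_△(v 1, w) = (θ₃ − y)·𝟙 + c'·v s + λ′·v 1 + c₁·v 1² + c·(v 1 · v t)`
for EVERY six-vector `w` (`thetaTri_v1_Lcrown`; the coefficients `λ′, c₁` are forced by coordinates 0 and 1), and the seed is in the cone
as soon as `D > 0`, `Δ₂ > 0`, `y ≥ 0`, `Δ₂ ≤ (1 − ρ)Δ₁`, `θ₃ ≥ y`, `c₁ ≥ 0`, `λ′ ≥ 0` (`InCone_thetaTri_v1_of_Lcrown`).  Its Hankel room is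
`P₂ − 1 ≳ 1.2 (1 − A)²/P₁` — the numerically observed frontier of the cone — and it covers the stars with `A ≥ 1/2` (C041SeedCoverCrown).
-/

namespace PercRepro

namespace RelaxedTriangle

open TreeClosure

/-- **THE IDENTITY L_crown.** For every six-vector `w`, every split `ρ` and the quantities
`Δ₁ = 4L₀ + 2L₂ + 4M₀ − 6M₁ − 4M₂`, `Δ₂ = 4L₂ − 4L₀ − 2M₂ + 2M₀`, `D = 2L₂ − 2L₀ + 2M₂ − 2M₀`, `y = ρΔ₁`, `s = y/(y + D)`,
`c' = (y + D)²/D`, `t = 1 − Δ₂/((1 − ρ)Δ₁)`, `c = ((1 − ρ)Δ₁)²/Δ₂`, `c₀ = θ₃ − y`, `M = θ₀ − c₀ − c' − c`,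
`N = θ₁ − c₀ − c'(1 + s²) − 2c(1 + t²)`, `c₁ = (N − 2M)/2`, `λ′ = (4M − N)/2` (with `D, Δ₂, y + D, (1 − ρ)Δ₁ ≠ 0`):
`θ_△(v 1, w) = c₀·𝟙 + c'·v s + λ′·v 1 + c₁·v 1² + c·(v 1 · v t)`. -/
theorem thetaTri_v1_Lcrown (w : Vec6) (r D1 D2 D y s cp t c c0 M N c1 lam : ℝ)
    (hD1 : D1 = 4 * w 0 + 2 * w 2 + 4 * w 3 - 6 * w 4 - 4 * w 5)
    (hD2 : D2 = 4 * w 2 - 4 * w 0 - 2 * w 5 + 2 * w 3)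
    (hD : D = 2 * w 2 - 2 * w 0 + 2 * w 5 - 2 * w 3)
    (hy : y = r * D1) (hs : s = y / (y + D)) (hcp : cp = (y + D) ^ 2 / D)
    (ht : t = 1 - D2 / ((1 - r) * D1)) (hc : c = ((1 - r) * D1) ^ 2 / D2)
    (hc0 : c0 = 2 * w 0 + w 3 + 2 * w 4 + w 5 - y)
    (hM : M = 2 * w 0 + 5 * w 1 + 4 * w 2 - c0 - cp - c)
    (hN : N = 16 * w 1 + 5 * w 2 - 5 * w 0 - c0 - cp * (1 + s ^ 2) - 2 * c * (1 + t ^ 2))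
    (hc1 : c1 = (N - 2 * M) / 2) (hlam : lam = (4 * M - N) / 2)
    (hD0 : D ≠ 0) (hD20 : D2 ≠ 0) (hyD : y + D ≠ 0) (hrD1 : (1 - r) * D1 ≠ 0) :
    thetaTri (v 1) w = c0 • (1 : Vec6) + cp • v s + lam • v 1 + c1 • (v 1 * v 1) + c • (v 1 * v t) := by
  have hs' : s * (y + D) = y := by rw [hs]; field_simp
  have h1s : (1 - s) * (y + D) = D := by rw [hs]; field_simp; ring
  have hcp1 : cp * (1 - s) = y + D := by
    rw [hcp, hs]; field_simp; ring
  have hcps : cp * (s * (1 - s)) = y := by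
    have e : cp * (s * (1 - s)) = s * (cp * (1 - s)) := by ring
    rw [e, hcp1, hs']
  have hcp2 : cp * (1 - s) ^ 2 = D := by
    have e : cp * (1 - s) ^ 2 = (1 - s) * (cp * (1 - s)) := by ring
    rw [e, hcp1]
    exact h1s
  have hct1 : c * (1 - t) = (1 - r) * D1 := by
    rw [hc, ht, sub_sub_cancel]; field_simp
  have hct2 : c * (1 - t) ^ 2 = D2 := by
    have e : c * (1 - t) ^ 2 = (1 - t) * (c * (1 - t)) := by ring
    rw [e, hct1, ht, sub_sub_cancel]
    exact div_mul_cancel₀ D2 hrD1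
  rw [thetaTri_v1_coords]
  ext i
  simp only [Pi.add_apply, Pi.smul_apply, Pi.mul_apply, Pi.one_apply, smul_eq_mul, v]
  fin_cases i <;> simp
  · linear_combination -hM - hlam - hc1
  · linear_combination -(2 * hlam + 4 * hc1 + hN)
  · linear_combination -hM - hlam - hc1 - hcp2 - hct2 - hD - hD2
  · linear_combination -hc0 - hcps
  · linear_combination -hM - hlam - hc1 + hcp1 + hct1 + hD + hD1 + hy
  · linear_combination -hc0 - hcp1 - hD

/-- **THEOREM (SEED, L_crown-REGION)**: with the quantities of `thetaTri_v1_Lcrown`, if `0 ≤ ρ < 1`, `D > 0`, `Δ₂ > 0`, `Δ₁ ≥ 0`,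
`Δ₂ ≤ (1 − ρ)Δ₁`, `c₀ ≥ 0`, `c₁ ≥ 0` and `λ′ ≥ 0`, then `θ_△(v 1, w)` lies in the cone. -/
theorem InCone_thetaTri_v1_of_Lcrown (w : Vec6) (r D1 D2 D y s cp t c c0 M N c1 lam : ℝ)
    (hD1 : D1 = 4 * w 0 + 2 * w 2 + 4 * w 3 - 6 * w 4 - 4 * w 5)
    (hD2 : D2 = 4 * w 2 - 4 * w 0 - 2 * w 5 + 2 * w 3)
    (hD : D = 2 * w 2 - 2 * w 0 + 2 * w 5 - 2 * w 3)
    (hy : y = r * D1) (hs : s = y / (y + D)) (hcp : cp = (y + D) ^ 2 / D)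
    (ht : t = 1 - D2 / ((1 - r) * D1)) (hc : c = ((1 - r) * D1) ^ 2 / D2)
    (hc0 : c0 = 2 * w 0 + w 3 + 2 * w 4 + w 5 - y)
    (hM : M = 2 * w 0 + 5 * w 1 + 4 * w 2 - c0 - cp - c)
    (hN : N = 16 * w 1 + 5 * w 2 - 5 * w 0 - c0 - cp * (1 + s ^ 2) - 2 * c * (1 + t ^ 2))
    (hc1 : c1 = (N - 2 * M) / 2) (hlam : lam = (4 * M - N) / 2)
    (hr0 : 0 ≤ r) (hr1 : r < 1) (hDpos : 0 < D) (hD2pos : 0 < D2) (hD1nn : 0 ≤ D1) (htnn : D2 ≤ (1 - r) * D1)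
    (hc0nn : 0 ≤ c0) (hc1nn : 0 ≤ c1) (hlamnn : 0 ≤ lam) :
    InCone (thetaTri (v 1) w) := by
  have hr1' : 0 < 1 - r := by linarith
  have hrD1 : 0 < (1 - r) * D1 := lt_of_lt_of_le hD2pos htnn
  have hynn : 0 ≤ y := by rw [hy]; exact mul_nonneg hr0 hD1nn
  have hyD : 0 < y + D := by linarith
  rw [thetaTri_v1_Lcrown w r D1 D2 D y s cp t c c0 M N c1 lam hD1 hD2 hD hy hs hcp ht hc hc0 hM hN hc1 hlam hDpos.ne'
    hD2pos.ne' hyD.ne' hrD1.ne']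
  have hs0 : 0 ≤ s := by rw [hs]; exact div_nonneg hynn hyD.le
  have hs1 : s ≤ 1 := by rw [hs, div_le_one hyD]; linarith
  have ht0 : 0 ≤ t := by
    rw [ht, sub_nonneg, div_le_one hrD1]
    exact htnn
  have ht1 : t ≤ 1 := by
    rw [ht]
    have : 0 ≤ D2 / ((1 - r) * D1) := div_nonneg hD2pos.le hrD1.le
    linarith
  have hcpnn : 0 ≤ cp := by rw [hcp]; positivity
  have hcnn : 0 ≤ c := by rw [hc]; positivity
  refine InCone.add (InCone.add (InCone.add (InCone.add ?_ ?_) ?_) ?_) ?_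
  · exact InCone.smul _ hc0nn InCone_one
  · exact InCone.smul _ hcpnn (InCone_v s ⟨hs0, hs1⟩)
  · exact InCone.smul _ hlamnn (InCone_v 1 ⟨zero_le_one, le_rfl⟩)
  · exact InCone.smul _ hc1nn ((InCone_v 1 ⟨zero_le_one, le_rfl⟩).mul_v zero_le_one le_rfl)
  · exact InCone.smul _ hcnn ((InCone_v 1 ⟨zero_le_one, le_rfl⟩).mul_v ht0 ht1)

end RelaxedTriangle

end PercRepro
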